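import Literature.Claims.NS.Passolungo2025
import Literature.Claims.NS.ClayTorusBridge
import Literature.Analysis.FluidPDE.TorusNSStrainSupContinuation
import Literature.Analysis.FluidPDE.ClassicalSolutionTorusProofs
import Literature.Analysis.FunctionSpaces.TorusSupNormContinuity
import Literature.Analysis.FunctionSpaces.TorusMollifier
import Literature.Analysis.FunctionSpaces.FlatTorusProofs
import HarnessLib

/-!
# Solo salvage for claim C144 `Passolungo2025` (cell `ns-claims`, D-0090): Step 10 «mini-BKM»
# (`ClaimedTheorem → ClaimedRegularity`, p.5 l.6–7 / p.1 l.19–20) is TRUE — the deformation-tensor form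
# of Beale–Kato–Majda on `𝕋³`, kernel

Claim skeleton: `Literature/Claims/NS/Passolungo2025.lean` (S. Passolungo, Zenodo 17251544; typist
`ns-claims-typist-6` g5, p523658). Its `Step10_MiniBKM : ClaimedTheorem → ClaimedRegularity` is the only
classical link of the chain («From ∂ₜ|ω| ≤ ‖S‖_∞|ω| + νΔ|ω|, Grönwall excludes finite-time blow-up;
smoothness and uniqueness propagate globally»): an a-priori bound `∫₀ᵀ ‖S‖_{L∞} dt < ∞` along every
periodic classical solution on every `[0, T)` implies a global smooth periodic solution for every
admissible (mean-zero) datum. This file (seat `ns-claims-salvage-p3` g4) PROVES it from the tree: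

* the maximal classical solution on `𝕋³` with the enstrophy blow-up alternative
  (`Torus.exists_maximal_classicalNS_anyMean`, RRS 2016 §6.3/§8.1), lifted to the periodic `ℝ³` class
  (`IsClassicalNSSolutionOn.of_torus_holds`, `Torus.isLatticePeriodic_lift`) so that `ClaimedTheorem`
  applies to it and yields `∫⁻_{(0,T*)} ⨆ₓ ‖S‖ₑ < ⊤`;
* the strain-form enstrophy Grönwall bound `Torus.torusEnstrophy_le_mul_exp_integral_strainBound`
  (`Literature/Analysis/FluidPDE/TorusNSStrainSupContinuation.lean`, this seat, p523120) with the
  CONTINUOUS entrywise majorant `M(t) = ‖w(t)‖_∞`, `w` the jointly smooth field of doubled strain entries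
  (`IsSmoothSpaceTimeOn.continuousOn_toReal_eSupNorm`), whose primitive is bounded by `4·toReal` of the
  claimed integral (entries ≤ Hilbert–Schmidt ≤ `2·`operator norm);
* hence the enstrophy is bounded on `[0, T*)`, excluding the blow-up branch; the global branch is Clay (B)
  solvability of the lifted datum (`clayPeriodic_solvable_lift_iff`).

* `step10_holds : Literature.Claims.NS.Passolungo2025.Step10_MiniBKM`.

Solo lane (`Theorems/SoloSalvage<Slug>….lean`, no item); records-grade, no token effect.

WHAT THIS IS NOT: not a claim about NS regularity or blow-up; not a claim about any author beyond the
typed locator.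
-/

noncomputable section

set_option linter.dupNamespace false

open Set MeasureTheory Finset
open scoped ENNReal InnerProductSpace RealInnerProductSpace

namespace Summit.NavierStokesRegularity.NavierStokesRegularity.Theorems.Passolungo2025Salvage

open Literature.Analysis Literature.Analysis.FluidPDE Literature.Analysis.FunctionSpaces
open Literature.Claims.NS Literature.Claims.NS.Passolungo2025 Literature.Claims.NS.ClayVariants
open Literature.Claims.NS.PaiLimsuwan2026 (E3 strain)

/-! ## §1 The field of doubled strain entries of a torus field and its sup norm

Throughout, the doubled strain entries `2Sᵢⱼ(x) = (∂ⱼUᵢ + ∂ᵢUⱼ)(x)` of a torus field `U` are packaged as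
the vector `∑_{(i,j)} (∂ⱼUᵢ + ∂ᵢUⱼ)(x) • e_{(i,j)}` of `ℝ^{3×3}` (no new definitions: the expression is
spelled out). -/

/-- Coordinates of a packed vector `∑_q e(q) • e_q`. [folklore] -/
private theorem pack_apply (e : Fin 3 × Fin 3 → ℝ) (q : Fin 3 × Fin 3) :
    (∑ q' : Fin 3 × Fin 3, e q' • EuclideanSpace.single q' (1 : ℝ)) q = e q := by
  simp only [EuclideanSpace.single, WithLp.ofLp_sum, Finset.sum_apply, WithLp.ofLp_smul,
    Pi.smul_apply, PiLp.single_apply, smul_eq_mul, mul_ite, mul_one, mul_zero]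
  rw [Finset.sum_ite_eq]
  simp

/-- `|e(q)| ≤ ‖∑_q e(q) • e_q‖`. [folklore] -/
private theorem abs_le_norm_pack (e : Fin 3 × Fin 3 → ℝ) (q : Fin 3 × Fin 3) :
    |e q| ≤ ‖∑ q' : Fin 3 × Fin 3, e q' • EuclideanSpace.single q' (1 : ℝ)‖ := by
  have h := Torus.abs_apply_le_norm (∑ q' : Fin 3 × Fin 3, e q' • EuclideanSpace.single q' (1 : ℝ)) q
  rwa [pack_apply] at h

/-- Joint smoothness of the entry field along a jointly smooth space–time field. [folklore] -/
private theorem isSmoothSpaceTimeOn_pack {S : Set ℝ} (hS : UniqueDiffOn ℝ S)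
    {U : ℝ → UnitAddTorus (Fin 3) → E3} (hU : Torus.IsSmoothSpaceTimeOn S U) :
    Torus.IsSmoothSpaceTimeOn S (fun t x => ∑ q : Fin 3 × Fin 3,
      (Torus.partialDeriv q.2 (U t) x q.1 + Torus.partialDeriv q.1 (U t) x q.2) •
        EuclideanSpace.single q (1 : ℝ)) := by
  refine Torus.IsSmoothSpaceTimeOn.sum fun q _ => ?_
  refine Torus.IsSmoothSpaceTimeOn.smul ?_
    (Torus.isSmoothSpaceTimeOn_const (Torus.isSmooth_const _) S)
  exact ((hU.partialDeriv hS q.2).apply q.1).add ((hU.partialDeriv hS q.1).apply q.2)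

/-! ## §2 Entries versus the operator norm of the strain of the lift -/

/-- The doubled entry is twice the matrix entry of `strain (lift U)` at a representative:
`(∂ⱼUᵢ + ∂ᵢUⱼ)(x) = 2 ⟪strain (lift U) (repr x) eⱼ, eᵢ⟫`-coordinate. [folklore] -/
private theorem entry_eq_two_mul_strain (U : UnitAddTorus (Fin 3) → E3) (hU : Torus.IsContDiff 1 U)
    (x : UnitAddTorus (Fin 3)) (i j : Fin 3) :
    Torus.partialDeriv j U x i + Torus.partialDeriv i U x j =
      2 * (strain (Torus.lift U) (Torus.repr x) (EuclideanSpace.single j (1 : ℝ))) i := by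
  have hB : fderiv ℝ (Torus.lift U) (Torus.repr x) = Torus.fderiv U x := by
    rw [Torus.fderiv_lift, Torus.proj_repr]
  have hij : (Torus.fderiv U x (EuclideanSpace.single j (1 : ℝ))) i = Torus.partialDeriv j U x i := by
    rw [Torus.partialDeriv_eq_fderiv_apply hU]
  have hji : (ContinuousLinearMap.adjoint (Torus.fderiv U x) (EuclideanSpace.single j (1 : ℝ))) i =
      Torus.partialDeriv i U x j := by
    have h1 : (ContinuousLinearMap.adjoint (Torus.fderiv U x) (EuclideanSpace.single j (1 : ℝ))) i =
        ⟪ContinuousLinearMap.adjoint (Torus.fderiv U x) (EuclideanSpace.single j (1 : ℝ)),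
          EuclideanSpace.single i (1 : ℝ)⟫_ℝ := by
      rw [EuclideanSpace.inner_single_right]; simp
    rw [h1, ContinuousLinearMap.adjoint_inner_left, EuclideanSpace.inner_single_left,
      Torus.partialDeriv_eq_fderiv_apply hU]
    simp
  simp only [strain, hB, _root_.smul_apply, _root_.add_apply, PiLp.smul_apply, PiLp.add_apply,
    smul_eq_mul, hij, hji]
  ring

/-- `‖∑_{(i,j)} (∂ⱼUᵢ + ∂ᵢUⱼ)(x) • e_{(i,j)}‖ ≤ 4 ‖strain (lift U) (repr x)‖` (entries ≤ Hilbert–Schmidt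
≤ `√3`·operator norm). [folklore] -/
private theorem norm_pack_le (U : UnitAddTorus (Fin 3) → E3) (hU : Torus.IsContDiff 1 U)
    (x : UnitAddTorus (Fin 3)) :
    ‖∑ q : Fin 3 × Fin 3, (Torus.partialDeriv q.2 U x q.1 + Torus.partialDeriv q.1 U x q.2) •
        EuclideanSpace.single q (1 : ℝ)‖ ≤ 4 * ‖strain (Torus.lift U) (Torus.repr x)‖ := by
  set A := strain (Torus.lift U) (Torus.repr x) with hA
  set w := ∑ q : Fin 3 × Fin 3, (Torus.partialDeriv q.2 U x q.1 + Torus.partialDeriv q.1 U x q.2) •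
        EuclideanSpace.single q (1 : ℝ) with hw
  have hnn : 0 ≤ ‖A‖ := norm_nonneg _
  -- `‖w‖² = Σ_{ij} (2 (A eⱼ)ᵢ)² = 4 Σⱼ ‖A eⱼ‖² ≤ 12 ‖A‖²`
  have hsq : ‖w‖ ^ 2 = ∑ q : Fin 3 × Fin 3, (2 * (A (EuclideanSpace.single q.2 (1 : ℝ))) q.1) ^ 2 := by
    rw [EuclideanSpace.norm_sq_eq]
    refine Finset.sum_congr rfl fun q _ => ?_
    rw [Real.norm_eq_abs, sq_abs, hw,
      pack_apply (fun q : Fin 3 × Fin 3 => Torus.partialDeriv q.2 U x q.1 + Torus.partialDeriv q.1 U x q.2)]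
    obtain ⟨i, j⟩ := q
    rw [entry_eq_two_mul_strain U hU x i j]
  have hcol : ∀ j : Fin 3, ∑ i : Fin 3, ((A (EuclideanSpace.single j (1 : ℝ))) i) ^ 2 ≤ ‖A‖ ^ 2 := by
    intro j
    have h1 : ∑ i : Fin 3, ((A (EuclideanSpace.single j (1 : ℝ))) i) ^ 2 =
        ‖A (EuclideanSpace.single j (1 : ℝ))‖ ^ 2 := by
      rw [EuclideanSpace.norm_sq_eq]
      refine Finset.sum_congr rfl fun i _ => ?_
      rw [Real.norm_eq_abs, sq_abs]
    rw [h1]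
    have h2 : ‖A (EuclideanSpace.single j (1 : ℝ))‖ ≤ ‖A‖ := by
      have := A.le_opNorm (EuclideanSpace.single j (1 : ℝ))
      simpa using this
    exact pow_le_pow_left₀ (norm_nonneg _) h2 2
  have hsum : ∑ q : Fin 3 × Fin 3, (2 * (A (EuclideanSpace.single q.2 (1 : ℝ))) q.1) ^ 2 ≤
      12 * ‖A‖ ^ 2 := by
    have h1 : ∑ q : Fin 3 × Fin 3, (2 * (A (EuclideanSpace.single q.2 (1 : ℝ))) q.1) ^ 2 =
        4 * ∑ j : Fin 3, ∑ i : Fin 3, ((A (EuclideanSpace.single j (1 : ℝ))) i) ^ 2 := by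
      rw [Finset.mul_sum, ← Finset.univ_product_univ, Finset.sum_product_right]
      refine Finset.sum_congr rfl fun j _ => ?_
      rw [Finset.mul_sum]
      refine Finset.sum_congr rfl fun i _ => ?_
      ring
    rw [h1]
    have h2 : ∑ j : Fin 3, ∑ i : Fin 3, ((A (EuclideanSpace.single j (1 : ℝ))) i) ^ 2 ≤ 3 * ‖A‖ ^ 2 := by
      calc ∑ j : Fin 3, ∑ i : Fin 3, ((A (EuclideanSpace.single j (1 : ℝ))) i) ^ 2
          ≤ ∑ _j : Fin 3, ‖A‖ ^ 2 := Finset.sum_le_sum fun j _ => hcol j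
        _ = 3 * ‖A‖ ^ 2 := by simp
    linarith
  have h16 : ‖w‖ ^ 2 ≤ (4 * ‖A‖) ^ 2 := by
    rw [hsq]; nlinarith [hsum, hnn]
  exact (pow_le_pow_iff_left₀ (norm_nonneg _) (by positivity) two_ne_zero).1 h16

/-- The sup norm of the entry field is dominated by `4 ·` the `L^∞` size of the strain of the lift.
[folklore] -/
private theorem eSupNorm_pack_le (U : UnitAddTorus (Fin 3) → E3) (hU : Torus.IsContDiff 1 U) :
    eSupNorm (fun x => ∑ q : Fin 3 × Fin 3,
        (Torus.partialDeriv q.2 U x q.1 + Torus.partialDeriv q.1 U x q.2) • EuclideanSpace.single q (1 : ℝ))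
      ≤ 4 * ⨆ y : E3, ‖strain (Torus.lift U) y‖ₑ := by
  refine iSup_le fun x => ?_
  calc ‖∑ q : Fin 3 × Fin 3, (Torus.partialDeriv q.2 U x q.1 + Torus.partialDeriv q.1 U x q.2) •
          EuclideanSpace.single q (1 : ℝ)‖ₑ
        = ENNReal.ofReal ‖∑ q : Fin 3 × Fin 3,
            (Torus.partialDeriv q.2 U x q.1 + Torus.partialDeriv q.1 U x q.2) •
              EuclideanSpace.single q (1 : ℝ)‖ := (ofReal_norm _).symm
    _ ≤ ENNReal.ofReal (4 * ‖strain (Torus.lift U) (Torus.repr x)‖) :=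
        ENNReal.ofReal_le_ofReal (norm_pack_le U hU x)
    _ = 4 * ‖strain (Torus.lift U) (Torus.repr x)‖ₑ := by
        rw [ENNReal.ofReal_mul (by norm_num), ofReal_norm]; norm_num
    _ ≤ 4 * ⨆ y : E3, ‖strain (Torus.lift U) y‖ₑ := by
        gcongr; exact le_iSup (fun y => ‖strain (Torus.lift U) y‖ₑ) (Torus.repr x)

/-! ## §3 The a-priori strain bound excludes the blow-up branch on the torus -/

/-- **A-priori `∫⁻⨆‖S‖ₑ < ⊤` ⇒ bounded enstrophy on `[0, T)`** for a classical torus solution whose lift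
satisfies the claimed bound on `(0, T)`. [cite: Passolungo2025, §13 p.5 l.6–7] [cite: RobinsonRodrigoSadowskiCUP2016, Thm 12.3] -/
theorem bddAbove_gradNormSq_of_strainSupIntegral_lt_top {ν T : ℝ} (hν : 0 < ν)
    {U : ℝ → UnitAddTorus (Fin 3) → E3} {P : ℝ → UnitAddTorus (Fin 3) → ℝ}
    (hsol : Torus.IsClassicalNSSolutionOn (Ico 0 T) ν 0 U P)
    (hJ : strainSupIntegral T (fun t => Torus.lift (U t)) < ⊤) :
    BddAbove ((fun t => Torus.gradNormSq (U t)) '' Ico 0 T) := by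
  set J : ℝ≥0∞ := strainSupIntegral T (fun t => Torus.lift (U t)) with hJdef
  set I : ℝ := (4 * J).toReal with hIdef
  have hJ4 : 4 * J ≠ ⊤ := ENNReal.mul_ne_top (by norm_num) hJ.ne
  refine ⟨Torus.gradNormSq (U 0) * Real.exp (8 * I), ?_⟩
  rintro _ ⟨t, ht, rfl⟩
  rcases ht.1.eq_or_lt with h0 | h0t
  · rw [← h0]
    have hg : 0 ≤ Torus.gradNormSq (U 0) :=
      integral_nonneg fun x => Finset.sum_nonneg fun i _ => sq_nonneg _
    have : (1 : ℝ) ≤ Real.exp (8 * I) := Real.one_le_exp (by positivity)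
    nlinarith
  -- the solution on the closed window `[0, t]`
  have hsub : Icc 0 t ⊆ Ico 0 T := fun s hs => ⟨hs.1, hs.2.trans_lt ht.2⟩
  have hsolt : Torus.IsClassicalNSSolutionOn (Icc 0 t) ν 0 U P := hsol.mono hsub (uniqueDiffOn_Icc h0t)
  -- the entry field `W` and the continuous entrywise majorant `M s = ‖W s‖_∞`
  set W : ℝ → UnitAddTorus (Fin 3) → EuclideanSpace ℝ (Fin 3 × Fin 3) := fun s x =>
    ∑ q : Fin 3 × Fin 3, (Torus.partialDeriv q.2 (U s) x q.1 + Torus.partialDeriv q.1 (U s) x q.2) •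
      EuclideanSpace.single q (1 : ℝ) with hWdef
  have hw : Torus.IsSmoothSpaceTimeOn (Icc 0 t) W :=
    isSmoothSpaceTimeOn_pack (uniqueDiffOn_Icc h0t) hsolt.smooth_velocity
  set M : ℝ → ℝ := fun s => (eSupNorm (W s)).toReal with hM
  have hMc : ContinuousOn M (Icc 0 t) := hw.continuousOn_toReal_eSupNorm
  have hM0 : ∀ s ∈ Icc 0 t, 0 ≤ M s := fun s _ => ENNReal.toReal_nonneg
  have hfin : ∀ s ∈ Icc 0 t, eSupNorm (W s) < ⊤ := fun s hs =>
    Torus.eSupNorm_lt_top_of_continuous (hw.isSmooth_slice hs).continuous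
  have hS : ∀ s ∈ Icc 0 t, ∀ x, ∀ i j,
      |(Torus.partialDeriv j (U s) x i + Torus.partialDeriv i (U s) x j) / 2| ≤ M s := by
    intro s hs x i j
    have hq := abs_le_norm_pack
      (fun q : Fin 3 × Fin 3 => Torus.partialDeriv q.2 (U s) x q.1 + Torus.partialDeriv q.1 (U s) x q.2)
      (i, j)
    have habs : |(Torus.partialDeriv j (U s) x i + Torus.partialDeriv i (U s) x j) / 2| ≤ ‖W s x‖ := by
      rw [abs_div, abs_two]
      have h0 : 0 ≤ ‖W s x‖ := norm_nonneg _
      have h1 : |Torus.partialDeriv j (U s) x i + Torus.partialDeriv i (U s) x j| ≤ ‖W s x‖ := hq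
      linarith [abs_nonneg (Torus.partialDeriv j (U s) x i + Torus.partialDeriv i (U s) x j)]
    refine habs.trans ?_
    have h1 : ‖W s x‖ₑ ≤ eSupNorm (W s) := enorm_le_eSupNorm _ x
    have h2 := ENNReal.toReal_mono (hfin s hs).ne h1
    rwa [toReal_enorm] at h2
  -- Grönwall in strain form
  have hgron := Torus.torusEnstrophy_le_mul_exp_integral_strainBound (d := Fin 3) (by simp) hν.le h0t
    hsolt hMc hM0 hS ⟨h0t.le, le_rfl⟩
  -- the primitive of `M` is bounded by `I = toReal (4 J)`
  have hC1 : ∀ s ∈ Icc 0 t, Torus.IsContDiff 1 (U s) := fun s hs =>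
    (hsolt.smooth_velocity.isSmooth_slice hs).isContDiff (by simp)
  have hMle : ∀ s ∈ Ioc 0 t, ENNReal.ofReal (M s) ≤ 4 * ⨆ y : E3, ‖strain (Torus.lift (U s)) y‖ₑ := by
    intro s hs
    have hs' : s ∈ Icc 0 t := ⟨hs.1.le, hs.2⟩
    rw [hM, ENNReal.ofReal_toReal (hfin s hs').ne]
    exact eSupNorm_pack_le (U s) (hC1 s hs')
  have hint : ∫ s in (0 : ℝ)..t, M s ≤ I := by
    have hmeas : AEStronglyMeasurable M (volume.restrict (Ioc 0 t)) :=
      (hMc.mono Ioc_subset_Icc_self).aestronglyMeasurable measurableSet_Ioc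
    have hnn : 0 ≤ᵐ[volume.restrict (Ioc 0 t)] M :=
      (ae_restrict_iff' measurableSet_Ioc).2 (ae_of_all _ fun s hs => hM0 s ⟨hs.1.le, hs.2⟩)
    rw [intervalIntegral.integral_of_le h0t.le, integral_eq_lintegral_of_nonneg_ae hnn hmeas, hIdef]
    refine ENNReal.toReal_mono hJ4 ?_
    calc ∫⁻ s in Ioc 0 t, ENNReal.ofReal (M s)
        ≤ ∫⁻ s in Ioc 0 t, 4 * ⨆ y : E3, ‖strain (Torus.lift (U s)) y‖ₑ :=
          setLIntegral_mono' measurableSet_Ioc fun s hs => hMle s hs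
      _ ≤ ∫⁻ s in Ioo 0 T, 4 * ⨆ y : E3, ‖strain (Torus.lift (U s)) y‖ₑ :=
          lintegral_mono_set fun s hs => ⟨hs.1, lt_of_le_of_lt hs.2 ht.2⟩
      _ = 4 * J := by
          rw [lintegral_const_mul' _ _ (by norm_num), hJdef, strainSupIntegral]
  -- conclude
  show Torus.gradNormSq (U t) ≤ Torus.gradNormSq (U 0) * Real.exp (8 * I)
  rw [gradNormSq_eq_two_mul_torusEnstrophy, gradNormSq_eq_two_mul_torusEnstrophy]
  have hexp : Real.exp (8 * ∫ s in (0 : ℝ)..t, M s) ≤ Real.exp (8 * I) :=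
    Real.exp_le_exp.2 (by linarith)
  have hE0 : 0 ≤ torusEnstrophy (U 0) := torusEnstrophy_nonneg _
  nlinarith [mul_le_mul_of_nonneg_left hexp hE0]

/-! ## §4 Step 10 -/

/-- **Step 10 «mini-BKM» holds**: `ClaimedTheorem → ClaimedRegularity` — an a-priori bound
`∫₀ᵀ‖S‖_∞ dt < ∞` along every periodic classical solution on every `[0,T)` gives, for every admissible
(smooth, periodic, mean-zero, divergence-free) datum and every `ν > 0`, a global smooth periodic solution
in Fefferman's class (Clay (B) solvability of the datum). Proof: descend the datum to `𝕋³`, take the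
maximal classical torus solution; its lift is a periodic classical solution from the datum on `[0, T*)`,
so the claimed bound holds for it and §3 bounds its enstrophy — the blow-up branch is impossible; the
global branch is the asserted solvability (`clayPeriodic_solvable_lift_iff`).
[cite: Passolungo2025, §13 p.5 l.6–7; §2 p.1 l.19–20] [cite: RobinsonRodrigoSadowskiCUP2016, §8.1 p. 122, Thm 12.3] -/
theorem step10_holds : Step10_MiniBKM := by
  intro hCT ν hν u₀ hd
  -- descend the datum
  set U₀ : UnitAddTorus (Fin 3) → E3 := fun y => u₀ (Torus.repr y) with hU₀
  have hlift : Torus.lift U₀ = u₀ := Torus.lift_descend_holds u₀ hd.periodic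
  have hs : Torus.IsSmooth U₀ := (contDiff_lift_iff_isSmooth U₀).1 (hlift ▸ hd.smooth)
  have hdiv : Torus.IsDivFree U₀ := (isDivFree_lift_iff_torus hs).1 (hlift ▸ hd.divFree)
  rw [← hlift, clayPeriodic_solvable_lift_iff]
  obtain ⟨U, P, hU0, hcases⟩ := Torus.exists_maximal_classicalNS_anyMean (d := Fin 3) (by simp) hν hs hdiv
  rcases hcases with ⟨hglob, -⟩ | ⟨T, hT, hsol, hnb, -⟩
  · exact ⟨U, P, hglob, hU0⟩
  · exfalso
    -- the lift is a periodic classical solution on `[0, T)` from `u₀`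
    have hlsol : IsClassicalNSSolutionOn (Ico 0 T) ν 0 (fun t => Torus.lift (U t))
        (fun t => Torus.lift (P t)) := by
      have h := IsClassicalNSSolutionOn.of_torus_holds (d := Fin 3) hsol
      have h0 : (fun t => Torus.lift ((0 : ℝ → UnitAddTorus (Fin 3) → E3) t)) = (0 : ℝ → E3 → E3) := by
        funext t x; simp [Torus.lift_apply]
      rw [h0] at h
      exact h
    have hss : IsSmoothSolutionOn (Ico 0 T) ν u₀ (fun t => Torus.lift (U t)) (fun t => Torus.lift (P t)) :=
      { solves := hlsol
        initial := by show Torus.lift (U 0) = u₀; rw [hU0, hlift]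
        periodic := fun t _ => Torus.isLatticePeriodic_lift (U t) }
    have hJ := hCT ν hν u₀ hd T hT _ _ hss
    exact hnb (bddAbove_gradNormSq_of_strainSupIntegral_lt_top hν hsol hJ)

end Summit.NavierStokesRegularity.NavierStokesRegularity.Theorems.Passolungo2025Salvage

end
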